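import Summits.HodgeConjecture.HodgeConjecture.Theorems.K2E1bDSCellUnitarizable        -- ★ U8-3 DATA∕LAWS + U8-4 brick: `spanDplus∕spanJplus∕spanDminus`, `vec_mem_span*_iff`, `im_eq_zero_and_re_neg_of_eq_ofReal_mul`
import Literature.RepresentationTheory.Kovacevic2021.SU21UnitarityNecessary              -- ★ `prodBC_of_isUnitarizable`, `prodAD_of_isUnitarizable` (Kovačević Thm 4, necessity)
import HarnessLib

/-!
# K2 ∕ E1b unit U8, Deal Q9b `K2E1bJStripNonUnitarizable`: the MIDDLE STRIPS `J_φ⁺ = [0,∞)×[a−b, a−c−1]` of `V(c_K⁺,2t⁺)` and `J_φ⁻ = [b−c, a−c−1]×[0,∞)` of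
# `V(c_K⁻,2t⁻)` are NOT UNITARIZABLE at a regular parameter (row U8-5 «[W] p. 176: J_φ^± non-unitary for m, n ≥ 2» in cell currency)

HCML Track B «K2-LIT», cell `hodgecm-mathlib`, crux H413 = stmt-HodgeConjecture-24833 (supports-only helper; closes nothing by itself).  Deal Q9b of K2E1b-plan (g3)
2026-09-04T01:55:59Z («BONUS J^± strips of width ≥ 2 NOT unitarizable = row U8-5 in cell currency: … `Theorems/K2E1bJStripNonUnitarizable.lean`»); hand K2E4-p10 (g2).
DEFINITIONS WITH BODY (`spanJminus`, `dsCellJplus`, `dsCellJminus`) + proved theorems; no `sorry`, no named `Prop` fact, no instance (one `attribute [local instance]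
LieRing.ofAssociativeRing`, the idiom of every ★ Kovačević file), no notation.

THE MATHEMATICS [Kovacevic2021 §4 Thm 4 (c35)∕(c30): unitarity forces `b_{nm} c_{n+1,m−3} < 0` on every `B`-edge and `a_{nm} d_{n+1,m+3} < 0` on every `A`-edge;
Rogawski1990 §12.3 p. 176 «J_φ⁺ is unitary iff n = 1, J_φ⁻ iff m = 1» (Wallach)].  The `J⁺`-constituent of the `(+)`-series is the subquotient
`N_{J⁺} ∕ N_{D⁺}` (★ `spanJplus` ∕ ★ `spanDplus`), `K`-types the strip `a−b ≤ q ≤ a−c−1`; under `IsRegularParam a b c` (`b − c ≥ 2`) it contains the `B`-EDGE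
`(p,q) = (0, a−b) → (0, a−b+1)`, on which the invariant product `B C′` of the subquotient IS that of the principal series (★ `subquotient_BC`) `= (q+1)·b⁺(q)∕(n(n+1))`
(★ `principalSeries_BC`) with `b⁺(a−b) = −((a−b)−(a−b−1))((a−b)−(a−c−1)) = b − c − 1 > 0` (★ LEVEL-B `bcoef_plus`) — a POSITIVE real, contradicting ★
`prodBC_of_isUnitarizable` (`re ≤ 0`).  Mirror for `J⁻`: the `A`-edge `(b−c, 0) → (b−c+1, 0)` (needs `a − b ≥ 2`) with `a⁻(b−c) = a − b − 1 > 0`.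

Sources: [Kovacevic2021] §3 Thm 3 (b75)∕(b80)∕(b85)∕(b90), §4 Thm 4; [Rogawski1990] §12.3 p. 176; [BorelWallach2000] VI Thm 4.12.  HONEST LABEL: HC_CM is proved only modulo
the 7 printed citations (2 remaining named inputs: hLiu418 = stmt-HodgeConjecture-24832, h413 = stmt-HodgeConjecture-24833) until rung 0 closes.
-/

set_option autoImplicit false
set_option linter.dupNamespace false

noncomputable section

namespace Summit.HodgeConjecture.HodgeConjecture.Cruxes.H413.K2E1bJStripNonUnitarizable

open Literature.RepresentationTheory.Kovacevic2021 Literature.RepresentationTheory.Kovacevic2021.SU21Datum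
open Literature.RepresentationTheory.Kovacevic2021.SU21Datum.PrincipalSeries
open Summit.HodgeConjecture.HodgeConjecture.Cruxes.H413.K2E1bGKCohomologyU21.U8 (IsRegularParam)
open Summit.HodgeConjecture.HodgeConjecture.Cruxes.H413.K2E1bGKCohomologyU21.U8.LevelB
open Summit.HodgeConjecture.HodgeConjecture.Cruxes.H413.K2E1bDSCellData

-- Mathlib idiom (Mathlib/Algebra/Lie/OfAssociative.lean), as in every ★ `Kovacevic2021` file and ★ `K2E1bDSCellData`.
attribute [local instance 100] LieRing.ofAssociativeRing

/-! ## §1 The `J`-strips as subquotient data -/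

/-- `N_{J⁻} = ⟨u^1 at (p,q) = (a−c−1, 0)⟩ ⊆ V(c_K⁻, 2t⁻)`: its `K`-types are the strip `p ≤ a − c − 1` (= `D_φ⁻ + J_φ⁻`). [cite: Kovacevic2021, §3 proof of Thm 3, Remark 6] -/
def spanJminus (a b c : ℤ) : LieSubmodule ℂ (Matrix (Fin 3) (Fin 3) ℂ) (principalSeries (cKMinus a b c) (tMinus a b c)).V :=
  LieSubmodule.lieSpan ℂ (Matrix (Fin 3) (Fin 3) ℂ)
    {(principalSeries (cKMinus a b c) (tMinus a b c)).vec (1 + (a - c - 1) + 0) (2 * tMinus a b c + 3 * (a - c - 1) - 3 * 0) 1}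

/-- **`J_φ⁺` as a Kovačević datum**: the subquotient `N_{J⁺} ∕ N_{D⁺}` of `V(c_K⁺,2t⁺)` — cone cell `[0,∞)×[a−b, a−c−1]` (strip of width `b − c`).
[cite: Rogawski1990, §12.3 p. 177] [cite: Kovacevic2021, §3 Remark 6] -/
def dsCellJplus (a b c : ℤ) : SU21Datum :=
  (principalSeries (cKPlus a b c) (tPlus a b c)).subquotient (spanDplus a b c) (spanJplus a b c)

/-- **`J_φ⁻` as a Kovačević datum**: the subquotient `N_{J⁻} ∕ N_{D⁻}` of `V(c_K⁻,2t⁻)` — cone cell `[b−c, a−c−1]×[0,∞)` (strip of width `a − b`).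
[cite: Rogawski1990, §12.3 p. 177] [cite: Kovacevic2021, §3 Remark 6] -/
def dsCellJminus (a b c : ℤ) : SU21Datum :=
  (principalSeries (cKMinus a b c) (tMinus a b c)).subquotient (spanDminus a b c) (spanJminus a b c)

section Regular

variable {a b c : ℤ}

/-- The `K`-types of `N_{J⁻}`: the strip `p ≤ a−c−1` (no `b`-root on the cone; the `a`-roots are at `b−c−1 < a−c−1`, crossing the first downwards is free).
[cite: Kovacevic2021, §3 proof of Thm 3, Remark 6] -/
theorem vec_mem_spanJminus_iff (h : IsRegularParam a b c) {p q : ℤ} (hp : 0 ≤ p) (hq : 0 ≤ q) :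
    (principalSeries (cKMinus a b c) (tMinus a b c)).vec (1 + p + q) (2 * tMinus a b c + 3 * p - 3 * q) 1 ∈ spanJminus a b c ↔
      p ≤ a - c - 1 := by
  obtain ⟨h1, h2⟩ := h
  rw [spanJminus, principalSeries_vec_mem_lieSpan_iff (cKMinus a b c) (tMinus a b c) (p₀ := a - c - 1) (q₀ := 0) (by omega) le_rfl hp hq]
  constructor
  · rintro ⟨ha, -⟩
    by_contra hlt
    exact ha (a - c - 1) le_rfl (by omega) ((acoef_minus_eq_zero_iff a b c _).2 (Or.inr rfl))
  · intro hle
    exact ⟨fun r hr hrp => by omega, fun s hs _ => bcoef_minus_ne_zero (by omega) (by omega) hs⟩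

/-- `K`-types of `J_φ⁺`'s datum: `p ≥ 0`, `a−b ≤ q ≤ a−c−1`. [cite: Kovacevic2021, §3 Remark 6] -/
theorem dsCellJplus_mem_sqSet_iff (h : IsRegularParam a b c) {p q : ℤ} (hp : 0 ≤ p) (hq : 0 ≤ q) :
    ((1 + p + q, 2 * tPlus a b c + 3 * p - 3 * q) : ℤ × ℤ) ∈
        (principalSeries (cKPlus a b c) (tPlus a b c)).sqSet (spanDplus a b c) (spanJplus a b c) ↔ a - b ≤ q ∧ q ≤ a - c - 1 := by
  rw [mem_sqSet_iff, vec_mem_spanJplus_iff h hp hq, vec_mem_spanDplus_iff h hp hq,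
    and_iff_right (show ((1 + p + q, 2 * tPlus a b c + 3 * p - 3 * q) : ℤ × ℤ) ∈ (principalSeries (cKPlus a b c) (tPlus a b c)).S from mem_cone hp hq rfl rfl)]
  omega

/-- `K`-types of `J_φ⁻`'s datum: `b−c ≤ p ≤ a−c−1`, `q ≥ 0`. [cite: Kovacevic2021, §3 Remark 6] -/
theorem dsCellJminus_mem_sqSet_iff (h : IsRegularParam a b c) {p q : ℤ} (hp : 0 ≤ p) (hq : 0 ≤ q) :
    ((1 + p + q, 2 * tMinus a b c + 3 * p - 3 * q) : ℤ × ℤ) ∈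
        (principalSeries (cKMinus a b c) (tMinus a b c)).sqSet (spanDminus a b c) (spanJminus a b c) ↔ b - c ≤ p ∧ p ≤ a - c - 1 := by
  rw [mem_sqSet_iff, vec_mem_spanJminus_iff h hp hq, vec_mem_spanDminus_iff h hp hq,
    and_iff_right (show ((1 + p + q, 2 * tMinus a b c + 3 * p - 3 * q) : ℤ × ℤ) ∈ (principalSeries (cKMinus a b c) (tMinus a b c)).S from mem_cone hp hq rfl rfl)]
  omega

/-! ## §2 Non-unitarizability (Kovačević Thm 4, necessity, on one internal edge) -/

/-- A positive real multiple of a complex number with positive real part (and zero imaginary part) has positive real part. [folklore] -/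
theorem re_pos_of_eq_ofReal_mul {r : ℝ} (hr : 0 < r) {w z : ℂ} (hz : z = (r : ℂ) * w) (hw : w.im = 0 ∧ 0 < w.re) : 0 < z.re := by
  subst hz
  rw [Complex.re_ofReal_mul]
  exact mul_pos hr hw.2

/-- `B C′` on `V(c,2t)` at the `K`-type `(p,q)` is the positive multiple `(q+1)∕(n(n+1))` of `b(q)` (★ `principalSeries_BC`, (b80)): a POSITIVE `b(q)` gives a
positive real part. [cite: Kovacevic2021, §3 Thm 3 (b80), §4 Thm 4 (c35)] -/
theorem ps_BC_re_pos (c₀ : ℂ) (t : ℤ) {p q : ℤ} (hp : 0 ≤ p) (hq : 0 ≤ q) (hb : (bcoef c₀ t q).im = 0 ∧ 0 < (bcoef c₀ t q).re) :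
    0 < ((principalSeries c₀ t).B (1 + p + q) (2 * t + 3 * p - 3 * q) * (principalSeries c₀ t).C (1 + p + q + 1) (2 * t + 3 * p - 3 * q - 3)).re := by
  refine re_pos_of_eq_ofReal_mul (r := ((q : ℝ) + 1) / ((1 + p + q) * (1 + p + q + 1))) ?_ ?_ hb
  · have : (0 : ℝ) ≤ p := by exact_mod_cast hp
    have : (0 : ℝ) ≤ q := by exact_mod_cast hq
    positivity
  · rw [principalSeries_BC c₀ t hp hq, bcoef]
    push_cast
    ring

/-- `A D′` on `V(c,2t)` at `(p,q)` is the positive multiple `(p+1)∕(n(n+1))` of `a(p)` (★ `principalSeries_AD`, (b75)). [cite: Kovacevic2021, §3 Thm 3 (b75), §4 Thm 4 (c30)] -/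
theorem ps_AD_re_pos (c₀ : ℂ) (t : ℤ) {p q : ℤ} (hp : 0 ≤ p) (hq : 0 ≤ q) (ha : (acoef c₀ t p).im = 0 ∧ 0 < (acoef c₀ t p).re) :
    0 < ((principalSeries c₀ t).A (1 + p + q) (2 * t + 3 * p - 3 * q) * (principalSeries c₀ t).D (1 + p + q + 1) (2 * t + 3 * p - 3 * q + 3)).re := by
  refine re_pos_of_eq_ofReal_mul (r := ((p : ℝ) + 1) / ((1 + p + q) * (1 + p + q + 1))) ?_ ?_ ha
  · have : (0 : ℝ) ≤ p := by exact_mod_cast hp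
    have : (0 : ℝ) ≤ q := by exact_mod_cast hq
    positivity
  · rw [principalSeries_AD c₀ t hp hq, acoef]
    push_cast
    ring

/-- On the `(+)`-series, `b⁺(a−b) = b − c − 1 > 0` (an internal `B`-edge of `J_φ⁺` under `IsRegularParam`). [cite: Kovacevic2021, §3 Thm 3 (b90)] -/
theorem bcoef_plus_pos (h : IsRegularParam a b c) :
    (bcoef (cKPlus a b c) (tPlus a b c) (a - b)).im = 0 ∧ 0 < (bcoef (cKPlus a b c) (tPlus a b c) (a - b)).re := by
  obtain ⟨h1, h2⟩ := h
  have hv : bcoef (cKPlus a b c) (tPlus a b c) (a - b) = ((b - c - 1 : ℤ) : ℂ) := by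
    rw [bcoef_plus]; push_cast; ring
  rw [hv, Complex.intCast_im, Complex.intCast_re]
  exact ⟨rfl, by exact_mod_cast (show (0 : ℤ) < b - c - 1 by omega)⟩

/-- On the `(−)`-series, `a⁻(b−c) = a − b − 1 > 0` (an internal `A`-edge of `J_φ⁻` under `IsRegularParam`). [cite: Kovacevic2021, §3 Thm 3 (b85)] -/
theorem acoef_minus_pos (h : IsRegularParam a b c) :
    (acoef (cKMinus a b c) (tMinus a b c) (b - c)).im = 0 ∧ 0 < (acoef (cKMinus a b c) (tMinus a b c) (b - c)).re := by
  obtain ⟨h1, h2⟩ := h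
  have hv : acoef (cKMinus a b c) (tMinus a b c) (b - c) = ((a - b - 1 : ℤ) : ℂ) := by
    rw [acoef_minus]; push_cast; ring
  rw [hv, Complex.intCast_im, Complex.intCast_re]
  exact ⟨rfl, by exact_mod_cast (show (0 : ℤ) < a - b - 1 by omega)⟩

/-- **`J_φ⁺` is NOT unitarizable at a regular parameter**: on the `B`-edge `(0, a−b) → (0, a−b+1)` of the strip (inside it since `b − c ≥ 2`) the invariant product
`B C′` of the subquotient IS that of the principal series (★ `subquotient_BC`), a positive multiple of `b⁺(a−b) = b − c − 1 > 0`, whereas unitarity forces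
`re (B C′) ≤ 0` on every edge (★ `prodBC_of_isUnitarizable`). [cite: Kovacevic2021, §4 Thm 4 (c35)] [cite: Rogawski1990, §12.3 p. 176] -/
theorem dsCellJplus_not_isUnitarizable (h : IsRegularParam a b c) : ¬ IsUnitarizable (dsCellJplus a b c) := by
  intro hU
  have hreg := h
  obtain ⟨h1, h2⟩ := h
  have hab : (0 : ℤ) ≤ a - b := by omega
  have hx : ((1 + 0 + (a - b), 2 * tPlus a b c + 3 * 0 - 3 * (a - b)) : ℤ × ℤ) ∈ (dsCellJplus a b c).S :=
    (dsCellJplus_mem_sqSet_iff hreg le_rfl hab).2 ⟨le_rfl, by omega⟩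
  have hy' : ((1 + 0 + (a - b + 1), 2 * tPlus a b c + 3 * 0 - 3 * (a - b + 1)) : ℤ × ℤ) ∈ (dsCellJplus a b c).S :=
    (dsCellJplus_mem_sqSet_iff hreg (p := 0) (q := a - b + 1) le_rfl (by omega)).2 ⟨by omega, by omega⟩
  have hy : ((1 + 0 + (a - b) + 1, 2 * tPlus a b c + 3 * 0 - 3 * (a - b) - 3) : ℤ × ℤ) ∈ (dsCellJplus a b c).S := by
    have e1 : (1 + 0 + (a - b) + 1 : ℤ) = 1 + 0 + (a - b + 1) := by ring
    have e2 : (2 * tPlus a b c + 3 * 0 - 3 * (a - b) - 3 : ℤ) = 2 * tPlus a b c + 3 * 0 - 3 * (a - b + 1) := by ring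
    rw [e1, e2]; exact hy'
  obtain ⟨-, hre, -⟩ := prodBC_of_isUnitarizable _ hU hx hy
  have hBC : (dsCellJplus a b c).B (1 + 0 + (a - b)) (2 * tPlus a b c + 3 * 0 - 3 * (a - b)) *
        (dsCellJplus a b c).C (1 + 0 + (a - b) + 1) (2 * tPlus a b c + 3 * 0 - 3 * (a - b) - 3) =
      (principalSeries (cKPlus a b c) (tPlus a b c)).B (1 + 0 + (a - b)) (2 * tPlus a b c + 3 * 0 - 3 * (a - b)) *
        (principalSeries (cKPlus a b c) (tPlus a b c)).C (1 + 0 + (a - b) + 1) (2 * tPlus a b c + 3 * 0 - 3 * (a - b) - 3) :=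
    subquotient_BC hx
  rw [hBC] at hre
  exact absurd (ps_BC_re_pos _ _ le_rfl hab (bcoef_plus_pos hreg)) (not_lt.2 hre)

/-- **`J_φ⁻` is NOT unitarizable at a regular parameter**: mirror, on the `A`-edge `(b−c, 0) → (b−c+1, 0)` (inside the strip since `a − b ≥ 2`), with
`a⁻(b−c) = a − b − 1 > 0` against ★ `prodAD_of_isUnitarizable`. [cite: Kovacevic2021, §4 Thm 4 (c30)] [cite: Rogawski1990, §12.3 p. 176] -/
theorem dsCellJminus_not_isUnitarizable (h : IsRegularParam a b c) : ¬ IsUnitarizable (dsCellJminus a b c) := by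
  intro hU
  have hreg := h
  obtain ⟨h1, h2⟩ := h
  have hbc : (0 : ℤ) ≤ b - c := by omega
  have hx : ((1 + (b - c) + 0, 2 * tMinus a b c + 3 * (b - c) - 3 * 0) : ℤ × ℤ) ∈ (dsCellJminus a b c).S :=
    (dsCellJminus_mem_sqSet_iff hreg hbc le_rfl).2 ⟨le_rfl, by omega⟩
  have hy' : ((1 + (b - c + 1) + 0, 2 * tMinus a b c + 3 * (b - c + 1) - 3 * 0) : ℤ × ℤ) ∈ (dsCellJminus a b c).S :=
    (dsCellJminus_mem_sqSet_iff hreg (p := b - c + 1) (q := 0) (by omega) le_rfl).2 ⟨by omega, by omega⟩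
  have hy : ((1 + (b - c) + 0 + 1, 2 * tMinus a b c + 3 * (b - c) - 3 * 0 + 3) : ℤ × ℤ) ∈ (dsCellJminus a b c).S := by
    have e1 : (1 + (b - c) + 0 + 1 : ℤ) = 1 + (b - c + 1) + 0 := by ring
    have e2 : (2 * tMinus a b c + 3 * (b - c) - 3 * 0 + 3 : ℤ) = 2 * tMinus a b c + 3 * (b - c + 1) - 3 * 0 := by ring
    rw [e1, e2]; exact hy'
  obtain ⟨-, hre, -⟩ := prodAD_of_isUnitarizable _ hU hx hy
  have hAD : (dsCellJminus a b c).A (1 + (b - c) + 0) (2 * tMinus a b c + 3 * (b - c) - 3 * 0) *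
        (dsCellJminus a b c).D (1 + (b - c) + 0 + 1) (2 * tMinus a b c + 3 * (b - c) - 3 * 0 + 3) =
      (principalSeries (cKMinus a b c) (tMinus a b c)).A (1 + (b - c) + 0) (2 * tMinus a b c + 3 * (b - c) - 3 * 0) *
        (principalSeries (cKMinus a b c) (tMinus a b c)).D (1 + (b - c) + 0 + 1) (2 * tMinus a b c + 3 * (b - c) - 3 * 0 + 3) :=
    subquotient_AD hx
  rw [hAD] at hre
  exact absurd (ps_AD_re_pos _ _ hbc le_rfl (acoef_minus_pos hreg)) (not_lt.2 hre)

end Regular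

end Summit.HodgeConjecture.HodgeConjecture.Cruxes.H413.K2E1bJStripNonUnitarizable

end
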